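import Summits.BirchSwinnertonDyer.BirchSwinnertonDyer.Theorems.ErratumRoadFiveOpenInputIMCRest3
import Summits.BirchSwinnertonDyer.BirchSwinnertonDyer.Theorems.ErratumRoadFiveNormContinuityFromPrint
import HarnessLib

/-!
# Route `ErratumRoadFive`, crux `OpenInputIMC` (item stmt-BirchSwinnertonDyer-19061) and its child
# `OpenInputRamOffErratumLocus` (19274): modulo the ONE preprint input H3♭ (item 19270) and PUBLISHED
# named facts, the deciding crux of route K2 IS the residual REST‴ [(α) + (β)] plus the ¬(ram) child —
# the H2 child (19275) is no longer an input (file 6 of seat imc-p1; session g3)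

Cell `bsd-stepL` (run/shared/lean/pub/bsd-stepL/), seat `bsd-stepL-imc-p1` (prover; D-0074 row A),
session g3; `--supports stmt-BirchSwinnertonDyer-19061`. HONEST FRAMING: nothing here proves the crux
or BSD; `IMCDivAtErratumDataAll` (19270: the value-free divisibility H3♭ at every erratum datum ⇐
Castella's erratum Thm. 1.1 ⇐ [FW21, Thm. 4.41], PREPRINT) and `OpenInputNotRam` (19282) are OPEN route
items taken as HYPOTHESES; every published ∕ cited named fact is a hypothesis. THEOREMS ONLY; pure
composition of this seat's files 1, 4, 5 (p422211, p433634, p435026) with seat `bsd-stepL-bdp` g11's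
`ErratumRoadFiveNormContinuityFromPrint` (TARGET E ⟸ the PUBLISHED value-continuity fact
`castella2018Exceptional_bdpValueContinuity_trivialChar` (Castella JIMJ 2018 Thms. 2.10–2.11 + BDP13,
REVIEWED p434741) + the value-free core H3♭, by norm rigidity — so H2 leaves the road).

## What this file proves

* §1 `openInputOnTreeAt_of_oddNonsplitRam_of_localTorsion_of_core_of_castella2018Exceptional` —
  pair level, ANY conductor: the (VN_p) fact + H3♭ pointwise (`P2.IMCDivIntCoreFrameAtErratumData W p`)
  + the published facts `hGZ86 hGZK hWu hSk hnf hCST hFH hMaz h331 hGZ hKo hPT hEP` + an odd non-split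
  (ram) witness + (iv) ⟹ `P2OpenInputOnTreeAt W p`. (File 4's pair theorem with H2 REPLACED by the
  published fact: lower half by file 1's `missingLowerBoundAt_of_erratumHypotheses_of_imcDivIntFrameAtErratumData`
  fed with bdp's `imcDivIntFrameAtErratumData_of_castella2018Exceptional_of_core`; control by JSW;
  one-sided tightness.)
* §2 `openInputRamOffErratumLocus_of_core_of_castella2018Exceptional_of_rest3` — child 19274 ⟸ the
  (VN_p) fact + `IMCDivAtErratumDataAll` (19270) + `PublishedInputsIMCReduction` (19283) +
  `WuthrichShaDividesAnalyticSha` (19285) + `thm331_anticyclotomicControl_mult` + REST‴ (NO 19275);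
  **`openInputIMC_of_core_of_castella2018Exceptional_of_rest3_of_notRam`** — the CRUX ⟸ the same +
  `OpenInputNotRam` (19282), via bdp's `openInputIMC_of_core_of_ramResidue_of_castella2018Exceptional_of_not_ram`;
  `…_of_atoms_of_notRam` — REST‴ split into (α) no odd non-split `E[p]`-ramified witness, (β)
  `E(ℚ_p)[p] ≠ 0`.

READING: with H2 cited from print (bdp g11) and control cited from print (imc-t1 g5 ∕ this seat), the
erratum road's ONLY non-published input is H3♭ = item 19270; modulo it and PUB facts the deciding crux
19061 is EXACTLY {REST‴ = (α) ∪ (β)} ∪ {¬(ram)} — cw (703 204 + 112 239) of 2 267 348 X11b-shape pairs at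
`p ≥ 5`, `N < 5·10⁵` (census folds of record), none of which the erratum's hypotheses (iii)–(iv) admit
(file 5 §2: REST‴ is exact). CONDITIONAL; nothing booked; closes rung K2 of BirchSwinnertonDyer for NO
pair by itself.

References: [Castella2018Erratum] Thm. 1.1, (2.4); [Castella2018Exceptional] Thms. 2.10–2.11
(arXiv:1507.04260); [BertoliniDarmonPrasanna2013] Prop. 5.10; [JetchevSkinnerWan2017] Thm. 3.3.1,
§3.5 (3.5.c); [Wuthrich2014] Prop. 21; [Castella2018] Thms. 3.1–3.2, §5; [Miller2011LMS] Def. 1.1.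
-/

set_option autoImplicit false
set_option linter.dupNamespace false

noncomputable section

open scoped Classical

open WeierstrassCurve NumberField IsDedekindDomain Field
open Literature.NumberTheory.EllipticCurves Literature.NumberTheory.EllipticCurves.GreenbergSelmer
open Literature.NumberTheory.EllipticCurves.ModularForms
open Literature.NumberTheory.EllipticCurves.Rank1Residual
open Literature.NumberTheory.EllipticCurves.Rank1Residual.Typed
open Literature.NumberTheory.EllipticCurves.Wuthrich2014
open Literature.NumberTheory.EllipticCurves.Castella2018
open Literature.NumberTheory.EllipticCurves.JetchevSkinnerWan2017
open Literature.NumberTheory.GaloisRepresentations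
open Literature.NumberTheory.GaloisCohomology
open Summit.BirchSwinnertonDyer.Rank1Residual Summit.BirchSwinnertonDyer.Rank1Residual.X11b
open Summit.BirchSwinnertonDyer.BirchSwinnertonDyer.Theses

namespace Summit.BirchSwinnertonDyer.BirchSwinnertonDyer.Theorems

/-! ### §1 Pair level: H3♭ + the published value-continuity fact, no H2 -/

section Pair

variable (W : WeierstrassCurve ℚ) [W.IsElliptic] [W.IsGloballyMinimal] (p : ℕ) [Fact p.Prime]

/-- **ANY conductor, odd non-split (ram) witness + (iv): the open input from H3♭ ALONE among the
non-published inputs.** For a globally minimal elliptic `W/ℚ`, a prime `p`, an ODD non-split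
multiplicative `q ≠ p` with `p ∤ v_q(Δ_min)` and (iv) `E(ℚ_p)[p] = 0`: the PUBLISHED value-continuity
fact `hF` (Castella JIMJ 2018 Thms. 2.10–2.11 + BDP13 Prop. 5.10, p434741) + H3♭ =
`P2.IMCDivIntCoreFrameAtErratumData W p` + `hGZ86 hGZK hWu hSk hnf hCST hFH hMaz hGZ hKo` + the JSW
control fact `h331` + the cited `hPT hEP` ⟹ `P2OpenInputOnTreeAt W p`. TARGET E at the erratum data
by bdp's `imcDivIntFrameAtErratumData_of_castella2018Exceptional_of_core` (norm rigidity), the lower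
half by file 1's `missingLowerBoundAt_of_erratumHypotheses_of_imcDivIntFrameAtErratumData`, control at
the classical data by `p2ControlOnTreeAt_of_thm331Mult`, the open input by one-sided tightness.
CONDITIONAL on H3♭ and the named facts; nothing booked.
[cite: Castella2018Erratum, Thm. 1.1, (2.4) (pp. 1, 4)]
[cite: Castella2018Exceptional, Thms. 2.10–2.11 (arXiv:1507.04260 pp. 13–14)]
[cite: JetchevSkinnerWan2017, Thm. 3.3.1 with §3.5 (3.5.c) (arXiv:1512.06894 pp. 11, 15)]
[cite: Wuthrich2014, Prop. 21 (p. 400)] [cite: Miller2011LMS, Def. 1.1] -/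
theorem openInputOnTreeAt_of_oddNonsplitRam_of_localTorsion_of_core_of_castella2018Exceptional
    (hF : castella2018Exceptional_bdpValueContinuity_trivialChar)
    (hGZ86 : GrossZagier1986_thm_I_7_3) (hGZK : rank_eq_analyticRank_of_analyticRank_le_one)
    (hWu : sha_dvd_analyticSha) (hSk : Skinner2016.thmC_padicValRat_bsd_rank_zero)
    (hnf : exists_isNewformOf) (hCST : CaiShuTian2014.thm11_trivialChar)
    (hFH : friedbergHoffstein_exists_twist_ne_zero_ramifiedAt)
    (hMaz : mazur_not_dvd_maninConstant_of_odd) (h331 : thm331_anticyclotomicControl_mult)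
    (hGZ : ∀ (N : ℕ) [NeZero N] (W : WeierstrassCurve ℚ) (K : Type) [Field K] [NumberField K],
      gross_zagier N W K)
    (hKo : ∀ (N : ℕ) [NeZero N] (W : WeierstrassCurve ℚ) (K : Type) [Field K] [NumberField K],
      kolyvagin N W K)
    (hPT : ∀ (K : Type) [Field K] [NumberField K], poitouTate_sum_localTatePairing_eq_zero K)
    (hEP : ∀ (K : Type) [Field K] [NumberField K] (v : HeightOneSpectrum (𝓞 K)),
      localEulerPoincareCharacteristic (v.adicCompletion K))
    (h3 : P2.IMCDivIntCoreFrameAtErratumData W p)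
    {q : ℕ} [Fact q.Prime] (hq2 : q ≠ 2) (hqp : q ≠ p) (hmq : Mult W q)
    (hnsq : ¬ W.HasSplitMultiplicativeReductionAtPrime q)
    (hvq : ¬ p ∣ padicValInt q W.minimalDiscriminantInt)
    (htors : ∀ P : (W.baseChange ℚ_[p]).toAffine.Point, p • P = 0 → P = 0) :
    P2OpenInputOnTreeAt W p := by
  refine p2OpenInputOnTreeAt_of_imp_surj W p fun hX hp5 _hs ↦ ?_
  have hr : W.analyticRank = 1 := hX.1
  have hram : Ram W p := ⟨q, ‹_›, hqp, hmq, hvq⟩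
  have hE : ErratumHypotheses W p := ⟨hp5, hX.2.2.1, hX.2.2.2, ⟨q, ‹_›, hqp, hmq, hnsq, hvq⟩, htors⟩
  have hD : P2.IMCDivIntFrameAtErratumData W p :=
    imcDivIntFrameAtErratumData_of_castella2018Exceptional_of_core (W := W) (p := p) hF h3
  have hlow : Typed.MissingLowerBoundAt W p :=
    missingLowerBoundAt_of_erratumHypotheses_of_imcDivIntFrameAtErratumData W p hGZ86 hGZK hWu hnf hCST
      hFH hMaz hPT hEP hD hE hq2 hqp hmq hnsq hvq hr
  exact openInputOnTreeAt_of_missingLowerBoundAt_of_ram W p hGZ hKo hSk hGZK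
    (hasEntireLFunction_rat_of_exists_isNewformOf hnf)
    (p2ControlOnTreeAt_of_thm331Mult W p h331 hKo) hram hlow

end Pair

/-! ### §2 Route level: child 19274 and the crux 19061 without the H2 child -/

section Route

/-- **CHILD 19274 from the (VN_p) fact, H3♭-all, the facts, JSW control and REST‴ — NO H2 child.**
`castella2018Exceptional_bdpValueContinuity_trivialChar` (PUBLISHED, p434741) → `IMCDivAtErratumDataAll`
(19270) → `PublishedInputsIMCReduction` (19283) → `WuthrichShaDividesAnalyticSha` (19285) →
`thm331_anticyclotomicControl_mult` (JSW17, PUBLISHED) → REST‴ → `OpenInputRamOffErratumLocus`.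
CONDITIONAL on 19270 and the named facts; nothing booked; no pair closed.
[cite: Castella2018Exceptional, Thms. 2.10–2.11 (arXiv:1507.04260 pp. 13–14)]
[cite: Castella2018Erratum, Thm. 1.1, (2.4) (pp. 1, 4)] [cite: Wuthrich2014, Prop. 21 (p. 400)]
[cite: JetchevSkinnerWan2017, Thm. 3.3.1 with §3.5 (3.5.c) (arXiv:1512.06894 pp. 11, 15)] -/
theorem openInputRamOffErratumLocus_of_core_of_castella2018Exceptional_of_rest3
    (hVN : castella2018Exceptional_bdpValueContinuity_trivialChar)
    (h3 : ErratumRoadFive.IMCDivAtErratumDataAll) (hF : ErratumRoadFive.PublishedInputsIMCReduction)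
    (hWu : ErratumRoadFive.WuthrichShaDividesAnalyticSha) (h331 : thm331_anticyclotomicControl_mult)
    (hrest : ∀ (W : WeierstrassCurve ℚ) [W.IsElliptic] [W.IsGloballyMinimal] (p : ℕ) [Fact p.Prime],
      Ram W p →
      ¬ ((∃ (q : ℕ) (_ : Fact q.Prime), q ≠ 2 ∧ q ≠ p ∧ Mult W q ∧
            ¬ W.HasSplitMultiplicativeReductionAtPrime q ∧
            ¬ p ∣ padicValInt q W.minimalDiscriminantInt) ∧
          (∀ P : (W.baseChange ℚ_[p]).toAffine.Point, p • P = 0 → P = 0)) →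
      P2OpenInputOnTreeAt W p) :
    ErratumRoadFive.OpenInputRamOffErratumLocus := by
  unfold ErratumRoadFive.IMCDivAtErratumDataAll at h3
  unfold ErratumRoadFive.WuthrichShaDividesAnalyticSha at hWu
  obtain ⟨hGZ86, hGZK, hSk, hnf, hCST, hFH, hMaz, hGZ, hKo, -, -, hPTs, -, -, hEP, -⟩ := hF
  refine openInputRamOffErratumLocus_of_oddNonsplitRam_localTorsion_of_rest3
    (fun W _ _ p _ hq htors ↦ ?_) hrest
  obtain ⟨q, _, hq2, hqp, hmq, hnsq, hvq⟩ := hq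
  exact openInputOnTreeAt_of_oddNonsplitRam_of_localTorsion_of_core_of_castella2018Exceptional W p hVN
    hGZ86 hGZK hWu hSk hnf hCST hFH hMaz h331 hGZ hKo hPTs hEP (h3 W p) hq2 hqp hmq hnsq hvq htors

/-- **THE CRUX 19061 `OpenInputIMC` MODULO ONE PREPRINT INPUT.** `castella2018Exceptional_bdpValueContinuity_trivialChar`
(PUBLISHED) → `IMCDivAtErratumDataAll` (19270, H3♭ — the only non-published input) →
`PublishedInputsIMCReduction` (19283) → `WuthrichShaDividesAnalyticSha` (19285) →
`thm331_anticyclotomicControl_mult` (PUBLISHED) → REST‴ → `OpenInputNotRam` (19282) → `OpenInputIMC`,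
via bdp g11's `openInputIMC_of_core_of_ramResidue_of_castella2018Exceptional_of_not_ram` (the H2 child
replaced by print) and the previous theorem (child 19274 from REST‴). So modulo H3♭ and published facts
the deciding crux of route K2 is EXACTLY the residual REST‴ [(α) ∪ (β), cw 703 204] plus the ¬(ram)
child [cw 112 239]. CONDITIONAL; nothing booked; no pair closed.
[cite: Castella2018Exceptional, Thms. 2.10–2.11 (arXiv:1507.04260 pp. 13–14)]
[cite: Castella2018Erratum, Thm. 1.1 (i)–(iv), (2.4) (pp. 1, 4)] [cite: Wuthrich2014, Prop. 21 (p. 400)]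
[cite: JetchevSkinnerWan2017, Thm. 3.3.1 with §3.5 (3.5.c) (arXiv:1512.06894 pp. 11, 15)]
[cite: Miller2011LMS, Def. 1.1] -/
theorem openInputIMC_of_core_of_castella2018Exceptional_of_rest3_of_notRam
    (hVN : castella2018Exceptional_bdpValueContinuity_trivialChar)
    (h3 : ErratumRoadFive.IMCDivAtErratumDataAll) (hF : ErratumRoadFive.PublishedInputsIMCReduction)
    (hWu : ErratumRoadFive.WuthrichShaDividesAnalyticSha) (h331 : thm331_anticyclotomicControl_mult)
    (hrest : ∀ (W : WeierstrassCurve ℚ) [W.IsElliptic] [W.IsGloballyMinimal] (p : ℕ) [Fact p.Prime],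
      Ram W p →
      ¬ ((∃ (q : ℕ) (_ : Fact q.Prime), q ≠ 2 ∧ q ≠ p ∧ Mult W q ∧
            ¬ W.HasSplitMultiplicativeReductionAtPrime q ∧
            ¬ p ∣ padicValInt q W.minimalDiscriminantInt) ∧
          (∀ P : (W.baseChange ℚ_[p]).toAffine.Point, p • P = 0 → P = 0)) →
      P2OpenInputOnTreeAt W p)
    (hOff : ErratumRoadFive.OpenInputNotRam) : ErratumRoadFive.OpenInputIMC :=
  openInputIMC_of_core_of_ramResidue_of_castella2018Exceptional_of_not_ram hVN h3
    (openInputRamOffErratumLocus_of_core_of_castella2018Exceptional_of_rest3 hVN h3 hF hWu h331 hrest)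
    hOff hF

/-- **The same with REST‴ split into the atoms (α), (β)** (file 4's
`rest3_of_noOddWitness_of_localTorsionNeZero`): the (VN_p) fact, H3♭-all, the facts, Wuthrich, JSW
control, (α) the (ram) pairs with NO odd non-split `E[p]`-ramified multiplicative `q ≠ p`, (β) the (ram)
pairs with `p` split, `p ∣ v_p(Δ_min)`, `p ∣ c_p` and a non-zero `p`-torsion point in `E(ℚ_p)`, and the
¬(ram) child ⟹ `OpenInputIMC`. Bookkeeping; CONDITIONAL; nothing booked.
[cite: Castella2018Erratum, Thm. 1.1 (iii)–(iv) (p. 1)]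
[cite: Castella2018Exceptional, Thms. 2.10–2.11 (arXiv:1507.04260 pp. 13–14)] -/
theorem openInputIMC_of_core_of_castella2018Exceptional_of_atoms_of_notRam
    (hVN : castella2018Exceptional_bdpValueContinuity_trivialChar)
    (h3 : ErratumRoadFive.IMCDivAtErratumDataAll) (hF : ErratumRoadFive.PublishedInputsIMCReduction)
    (hWu : ErratumRoadFive.WuthrichShaDividesAnalyticSha) (h331 : thm331_anticyclotomicControl_mult)
    (hα : ∀ (W : WeierstrassCurve ℚ) [W.IsElliptic] [W.IsGloballyMinimal] (p : ℕ) [Fact p.Prime],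
      Ram W p →
      (∀ (q : ℕ) [Fact q.Prime], q ≠ 2 → q ≠ p → Mult W q →
        ¬ W.HasSplitMultiplicativeReductionAtPrime q → p ∣ padicValInt q W.minimalDiscriminantInt) →
      P2OpenInputOnTreeAt W p)
    (hβ : ∀ (W : WeierstrassCurve ℚ) [W.IsElliptic] [W.IsGloballyMinimal] (p : ℕ) [Fact p.Prime],
      Ram W p → W.HasSplitMultiplicativeReductionAtPrime p →
      p ∣ padicValInt p W.minimalDiscriminantInt →
      p ∣ (W.baseChange ℚ_[p]).localTamagawaNumber ℤ_[p] →
      (∃ P : (W.baseChange ℚ_[p]).toAffine.Point, p • P = 0 ∧ P ≠ 0) → P2OpenInputOnTreeAt W p)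
    (hOff : ErratumRoadFive.OpenInputNotRam) : ErratumRoadFive.OpenInputIMC :=
  openInputIMC_of_core_of_castella2018Exceptional_of_rest3_of_notRam hVN h3 hF hWu h331
    (rest3_of_noOddWitness_of_localTorsionNeZero hα hβ) hOff

end Route

end Summit.BirchSwinnertonDyer.BirchSwinnertonDyer.Theorems

end
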